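import Summits.ABC.ABC.Theorems.TwistAmplificationSharpModerateLawCuspCoordinates
import Summits.ABC.ABC.Theorems.TwistAmplificationTwistAmplificationLemmaReduced
import Literature.NumberTheory.EllipticCurves.SzpiroOfAbcProofs

/-!
# Crux `TwistAmplification.SharpModerateLaw` (stmt-ABC-1975): realising a tower-free cusp pair by a reduced minimal model

Lead `prover-line-stmt-ABC-1975-c6-0` (line `unit-plane-conic-two-torsion`, skeleton v5.1), support for the CONVERSE
transfer `SharpModerateLaw → CoreLaw` (file `…TwistMinimalConverse.lean`): every pair `x = (c₄, c₆)` with `c₄c₆ ≠ 0`,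
`c₄³ ≠ c₆²` which is tower-free (`TF`) is, up to an admissible scaling by a divisor `m` of `36`, the pair of covariants of
a REDUCED integral Weierstrass model MINIMAL at every place:
`m⁴ · c₄(W) = 6⁴ · c₄`, `m⁶ · c₆(W) = 6⁶ · c₆` (`exists_reduced_minimal_model_of_tf`).

Construction: `W₁ = (0, 0, 0, −27c₄, −54c₆)` has covariants `(6⁴c₄, 6⁶c₆)`; take a global minimal model
`W₀ ⊗ ℚ = C • (W₁ ⊗ ℚ)` (`exists_baseChange_int_forall_isMinimalAt`, Silverman AEC VIII.8.3) and reduce it by an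
integral translation (`TwistAmplificationLemma.exists_reduced_model`). Writing `C.u = m/n` in lowest terms,
`m⁴ c₄(W₀) = 6⁴ c₄ n⁴`, `m⁶ c₆(W₀) = 6⁶ c₆ n⁶`; tower-freeness of `(c₄(W₀), c₆(W₀))` (minimality, Silverman AEC
Ex. 8.21, `tf_of_isMinimalAt`) forces `n = 1`, and tower-freeness of `(c₄, c₆)` forces `m ∣ 36` (`twistUnit_of_tf`).
-/

noncomputable section

-- the mandated summit namespace `Summit.ABC.ABC` (summit = problem) trips the duplicate-namespace linter
set_option linter.dupNamespace false

namespace Summit.ABC.ABC.Theorems.SharpModerateLaw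

open WeierstrassCurve IsDedekindDomain

/-! ## 1. The model `y² = x³ − 27c₄x − 54c₆` -/

/-- Covariant `c₄` of `(0, 0, 0, −27a, −54b)`: `6⁴ a`. -/
theorem cuspModel_c₄ (a b : ℤ) : (⟨0, 0, 0, -27 * a, -54 * b⟩ : WeierstrassCurve ℤ).c₄ = 1296 * a := by
  simp only [WeierstrassCurve.c₄, WeierstrassCurve.b₂, WeierstrassCurve.b₄]
  ring

/-- Covariant `c₆` of `(0, 0, 0, −27a, −54b)`: `6⁶ b`. -/
theorem cuspModel_c₆ (a b : ℤ) : (⟨0, 0, 0, -27 * a, -54 * b⟩ : WeierstrassCurve ℤ).c₆ = 46656 * b := by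
  simp only [WeierstrassCurve.c₆, WeierstrassCurve.b₂, WeierstrassCurve.b₄, WeierstrassCurve.b₆]
  ring

/-- Discriminant of `(0, 0, 0, −27a, −54b)`: `2⁶3⁹ (a³ − b²)`. -/
theorem cuspModel_Δ (a b : ℤ) :
    (⟨0, 0, 0, -27 * a, -54 * b⟩ : WeierstrassCurve ℤ).Δ = 1259712 * (a ^ 3 - b ^ 2) := by
  simp only [WeierstrassCurve.Δ, WeierstrassCurve.b₂, WeierstrassCurve.b₄, WeierstrassCurve.b₆,
    WeierstrassCurve.b₈]
  ring

/-! ## 2. Arithmetic of the scaling unit -/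

/-- `p ^ k ∣ a · b` and `p ∤ a` give `p ^ k ∣ b` (`p` prime, in `ℤ`). -/
theorem pow_dvd_of_pow_dvd_mul_of_not_dvd {p : ℕ} (hp : p.Prime) {a b : ℤ} {k : ℕ} (h : (p : ℤ) ^ k ∣ a * b)
    (ha : ¬ (p : ℤ) ∣ a) : (p : ℤ) ^ k ∣ b :=
  (Nat.prime_iff_prime_int.mp hp).pow_dvd_of_dvd_mul_left k ha h

/-- A prime `≥ 5` does not divide `2^i · 3^j`. -/
private theorem prime_five_le_not_dvd_two_pow_mul_three_pow {p : ℕ} (hp : p.Prime) (h5 : 5 ≤ p) (i j : ℕ) :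
    ¬ (p : ℤ) ∣ 2 ^ i * 3 ^ j := by
  intro h
  have hpZ := Nat.prime_iff_prime_int.mp hp
  rcases hpZ.dvd_or_dvd h with h2 | h3
  · have := Int.le_of_dvd (by norm_num) (hpZ.dvd_of_dvd_pow h2)
    omega
  · have := Int.le_of_dvd (by norm_num) (hpZ.dvd_of_dvd_pow h3)
    omega

/-- **The scaling unit.** If `m⁴ A = 6⁴ a n⁴`, `m⁶ B = 6⁶ b n⁶` with `gcd(m, n) = 1`, `n ≥ 1`, `a ≠ 0`, and both `(a, b)` and
`(A, B)` are tower-free, then `n = 1` and `m` is a non-zero divisor of `36`. -/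
theorem twistUnit_of_tf {a b A B m : ℤ} {n : ℕ} (ha : a ≠ 0) (hx : TF (a, b)) (hW : TF (A, B)) (hn : n ≠ 0)
    (hcop : m.natAbs.Coprime n) (h4 : m ^ 4 * A = 1296 * a * (n : ℤ) ^ 4)
    (h6 : m ^ 6 * B = 46656 * b * (n : ℤ) ^ 6) : n = 1 ∧ m ≠ 0 ∧ m ∣ 36 := by
  obtain ⟨hx5, hx2, hx3⟩ := hx
  obtain ⟨hW5, hW2, hW3⟩ := hW
  simp only at hx5 hx2 hx3 hW5 hW2 hW3
  have hm0 : m ≠ 0 := by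
    rintro rfl
    have : (1296 : ℤ) * a * (n : ℤ) ^ 4 = 0 := by rw [← h4]; ring
    have hn' : (n : ℤ) ≠ 0 := by exact_mod_cast hn
    exact absurd this (by positivity)
  -- (1) `n = 1`: a prime factor `p` of `n` is prime to `m`, so `p⁴ ∣ A`-type divisibilities contradict `TF (A, B)`
  have hn1 : n = 1 := by
    by_contra hne
    obtain ⟨p, hp, hpn⟩ := Nat.exists_prime_and_dvd hne
    have hpZ := Nat.prime_iff_prime_int.mp hp
    have hpm : ¬ (p : ℤ) ∣ m := by
      intro h
      have h1 : p ∣ m.natAbs := Int.natCast_dvd.mp h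
      have hg : p ∣ Nat.gcd m.natAbs n := Nat.dvd_gcd h1 hpn
      rw [hcop.gcd_eq_one] at hg
      exact hp.one_lt.ne' (Nat.dvd_one.mp hg)
    have hpm4 : ¬ (p : ℤ) ∣ m ^ 4 := fun h => hpm (hpZ.dvd_of_dvd_pow h)
    have hpm6 : ¬ (p : ℤ) ∣ m ^ 6 := fun h => hpm (hpZ.dvd_of_dvd_pow h)
    have hpnZ : (p : ℤ) ∣ (n : ℤ) := Int.natCast_dvd_natCast.mpr hpn
    -- `p^(4+i) ∣ m⁴ A` and `p^(6+j) ∣ m⁶ B` whenever `p^i ∣ 1296`, `p^j ∣ 46656`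
    have hA : ∀ i : ℕ, (p : ℤ) ^ i ∣ 1296 → (p : ℤ) ^ (i + 4) ∣ A := by
      intro i hi
      apply pow_dvd_of_pow_dvd_mul_of_not_dvd hp _ hpm4
      rw [h4, pow_add, mul_assoc]
      exact mul_dvd_mul hi (dvd_mul_of_dvd_right (pow_dvd_pow_of_dvd hpnZ 4) a)
    have hB : ∀ j : ℕ, (p : ℤ) ^ j ∣ 46656 → (p : ℤ) ^ (j + 6) ∣ B := by
      intro j hj
      apply pow_dvd_of_pow_dvd_mul_of_not_dvd hp _ hpm6
      rw [h6, pow_add, mul_assoc]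
      exact mul_dvd_mul hj (dvd_mul_of_dvd_right (pow_dvd_pow_of_dvd hpnZ 6) b)
    by_cases h2 : p = 2
    · subst h2
      refine hW2 ⟨?_, ?_⟩
      · exact_mod_cast hA 4 (by norm_num)
      · have h := hB 6 (by norm_num)
        push_cast at h
        exact (pow_dvd_pow 2 (by norm_num : 11 ≤ 6 + 6)).trans h
    by_cases h3 : p = 3
    · subst h3
      refine hW3 ⟨?_, ?_⟩
      · have h := hA 4 (by norm_num)
        push_cast at h
        exact (pow_dvd_pow 3 (by norm_num : 5 ≤ 4 + 4)).trans h
      · have h := hB 6 (by norm_num)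
        push_cast at h
        exact (pow_dvd_pow 3 (by norm_num : 9 ≤ 6 + 6)).trans h
    · have h5 : 5 ≤ p := by
        have h4' : p ≠ 4 := fun h => by rw [h] at hp; exact absurd hp (by decide)
        have := hp.two_le
        omega
      refine hW5 p hp h5 ⟨?_, ?_⟩
      · simpa using hA 0 (by simp)
      · simpa using hB 0 (by simp)
  subst hn1
  simp only [Nat.cast_one, one_pow, mul_one] at h4 h6
  -- (2) `m ∣ 36`: primes `≥ 5` do not divide `m`, `8 ∤ m`, `27 ∤ m`, by `TF (a, b)`
  have hno5 : ∀ p : ℕ, p.Prime → 5 ≤ p → ¬ (p : ℤ) ∣ m := by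
    intro p hp h5 hpm
    have hpZ := Nat.prime_iff_prime_int.mp hp
    refine hx5 p hp h5 ⟨?_, ?_⟩
    · have h : (p : ℤ) ^ 4 ∣ 1296 * a := h4 ▸ dvd_mul_of_dvd_left (pow_dvd_pow_of_dvd hpm 4) A
      exact pow_dvd_of_pow_dvd_mul_of_not_dvd hp h (by simpa using prime_five_le_not_dvd_two_pow_mul_three_pow hp h5 4 4)
    · have h : (p : ℤ) ^ 6 ∣ 46656 * b := h6 ▸ dvd_mul_of_dvd_left (pow_dvd_pow_of_dvd hpm 6) B
      exact pow_dvd_of_pow_dvd_mul_of_not_dvd hp h (by simpa using prime_five_le_not_dvd_two_pow_mul_three_pow hp h5 6 6)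
  have hno8 : ¬ (2 : ℤ) ^ 3 ∣ m := by
    intro hm
    refine hx2 ⟨?_, ?_⟩
    · have h : (2 : ℤ) ^ 12 ∣ 1296 * a := h4 ▸ dvd_mul_of_dvd_left (by simpa using pow_dvd_pow_of_dvd hm 4) A
      have h' : (2 : ℤ) ^ 4 * 2 ^ 8 ∣ 2 ^ 4 * (81 * a) := by
        rw [← pow_add]; convert h using 1; ring
      have h'' : (2 : ℤ) ^ 8 ∣ 81 * a := (mul_dvd_mul_iff_left (by norm_num)).mp h'
      exact pow_dvd_of_pow_dvd_mul_of_not_dvd Nat.prime_two (by exact_mod_cast h'') (by norm_num)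
    · have h : (2 : ℤ) ^ 18 ∣ 46656 * b := h6 ▸ dvd_mul_of_dvd_left (by simpa using pow_dvd_pow_of_dvd hm 6) B
      have h' : (2 : ℤ) ^ 6 * 2 ^ 12 ∣ 2 ^ 6 * (729 * b) := by
        rw [← pow_add]; convert h using 1; ring
      have h'' : (2 : ℤ) ^ 12 ∣ 729 * b := (mul_dvd_mul_iff_left (by norm_num)).mp h'
      have h12 : (2 : ℤ) ^ 12 ∣ b :=
        pow_dvd_of_pow_dvd_mul_of_not_dvd Nat.prime_two (by exact_mod_cast h'') (by norm_num)
      exact (pow_dvd_pow 2 (by norm_num)).trans h12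
  have hno27 : ¬ (3 : ℤ) ^ 3 ∣ m := by
    intro hm
    refine hx3 ⟨?_, ?_⟩
    · have h : (3 : ℤ) ^ 12 ∣ 1296 * a := h4 ▸ dvd_mul_of_dvd_left (by simpa using pow_dvd_pow_of_dvd hm 4) A
      have h' : (3 : ℤ) ^ 4 * 3 ^ 8 ∣ 3 ^ 4 * (16 * a) := by
        rw [← pow_add]; convert h using 1; ring
      have h'' : (3 : ℤ) ^ 8 ∣ 16 * a := (mul_dvd_mul_iff_left (by norm_num)).mp h'
      have h8 : (3 : ℤ) ^ 8 ∣ a :=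
        pow_dvd_of_pow_dvd_mul_of_not_dvd Nat.prime_three (by exact_mod_cast h'') (by norm_num)
      exact (pow_dvd_pow 3 (by norm_num)).trans h8
    · have h : (3 : ℤ) ^ 18 ∣ 46656 * b := h6 ▸ dvd_mul_of_dvd_left (by simpa using pow_dvd_pow_of_dvd hm 6) B
      have h' : (3 : ℤ) ^ 6 * 3 ^ 12 ∣ 3 ^ 6 * (64 * b) := by
        rw [← pow_add]; convert h using 1; ring
      have h'' : (3 : ℤ) ^ 12 ∣ 64 * b := (mul_dvd_mul_iff_left (by norm_num)).mp h'
      have h12 : (3 : ℤ) ^ 12 ∣ b :=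
        pow_dvd_of_pow_dvd_mul_of_not_dvd Nat.prime_three (by exact_mod_cast h'') (by norm_num)
      exact (pow_dvd_pow 3 (by norm_num)).trans h12
  -- assemble `m ∣ 36` prime by prime
  have hg0 : m.natAbs ≠ 0 := Int.natAbs_ne_zero.mpr hm0
  have hg36 : m.natAbs ∣ 36 := by
    refine (Nat.factorization_le_iff_dvd hg0 (by norm_num)).mp fun p => ?_
    by_cases hp : p.Prime
    swap
    · simp [Nat.factorization_eq_zero_of_not_prime _ hp]
    rw [← hp.pow_dvd_iff_le_factorization (by norm_num : (36 : ℕ) ≠ 0)]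
    have hk : p ^ (m.natAbs.factorization p) ∣ m.natAbs := Nat.ordProj_dvd _ _
    have hkZ : (p : ℤ) ^ (m.natAbs.factorization p) ∣ m := by
      rw [← Int.natAbs_dvd_natAbs]; simpa [Int.natAbs_pow] using hk
    by_cases h2 : p = 2
    · subst h2
      have hle : m.natAbs.factorization 2 ≤ 2 := by
        by_contra h
        push Not at h
        exact hno8 ((pow_dvd_pow (2 : ℤ) h).trans (by exact_mod_cast hkZ))
      exact (pow_dvd_pow 2 hle).trans (by norm_num)
    by_cases h3 : p = 3
    · subst h3
      have hle : m.natAbs.factorization 3 ≤ 2 := by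
        by_contra h
        push Not at h
        exact hno27 ((pow_dvd_pow (3 : ℤ) h).trans (by exact_mod_cast hkZ))
      exact (pow_dvd_pow 3 hle).trans (by norm_num)
    · have h5 : 5 ≤ p := by
        have h4' : p ≠ 4 := fun h => by rw [h] at hp; exact absurd hp (by decide)
        have := hp.two_le
        omega
      have hk0 : m.natAbs.factorization p = 0 := by
        by_contra h
        exact hno5 p hp h5 ((dvd_pow_self (p : ℤ) h).trans hkZ)
      rw [hk0, pow_zero]
      exact one_dvd _
  exact ⟨rfl, hm0, Int.natAbs_dvd_natAbs.mp (by simpa using hg36)⟩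

/-! ## 3. The realisation -/

/-- **Realisation of a tower-free cusp pair.** For `x = (c₄, c₆)` with `c₄ ≠ 0`, `c₆ ≠ 0`, `c₄³ ≠ c₆²`, tower-free, there
is a reduced integral model `W`, elliptic over `ℚ` and minimal at every place, and a non-zero divisor `m` of `36` with
`m⁴ c₄(W) = 6⁴ c₄` and `m⁶ c₆(W) = 6⁶ c₆`. -/
theorem exists_reduced_minimal_model_of_tf : ∀ (x : ℤ × ℤ), x.1 ≠ 0 → x.2 ≠ 0 → x.1 ^ 3 ≠ x.2 ^ 2 → TF x → ∃ W : WeierstrassCurve ℤ, (W.baseChange ℚ).IsElliptic ∧ (∀ v : IsDedekindDomain.HeightOneSpectrum ℤ, (W.baseChange ℚ).IsMinimalAt v) ∧ (W.a₁ = 0 ∨ W.a₁ = 1) ∧ (W.a₃ = 0 ∨ W.a₃ = 1) ∧ (W.a₂ = -1 ∨ W.a₂ = 0 ∨ W.a₂ = 1) ∧ ∃ m : ℤ, m ≠ 0 ∧ m ∣ 36 ∧ m ^ 4 * W.c₄ = 1296 * x.1 ∧ m ^ 6 * W.c₆ = 46656 * x.2 := by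
  intro x h1 h2 h3 hTF
  obtain ⟨a, b⟩ := x
  simp only at h1 h2 h3
  set W₁ : WeierstrassCurve ℤ := ⟨0, 0, 0, -27 * a, -54 * b⟩ with hW₁
  have hc₄ : W₁.c₄ = 1296 * a := cuspModel_c₄ a b
  have hc₆ : W₁.c₆ = 46656 * b := cuspModel_c₆ a b
  have hΔ₁ : W₁.Δ = 1259712 * (a ^ 3 - b ^ 2) := cuspModel_Δ a b
  have hΔ₁0 : W₁.Δ ≠ 0 := by
    rw [hΔ₁]; exact mul_ne_zero (by norm_num) (sub_ne_zero.mpr h3)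
  haveI hE₁ : (W₁.baseChange ℚ).IsElliptic :=
    ⟨by rw [baseChange_int_Δ]; exact isUnit_iff_ne_zero.mpr (by exact_mod_cast hΔ₁0)⟩
  obtain ⟨C, W₀, hCW, hmin₀⟩ := exists_baseChange_int_forall_isMinimalAt (W₁.baseChange ℚ)
  haveI hE₀ : (W₀.baseChange ℚ).IsElliptic := by rw [← hCW]; infer_instance
  obtain ⟨W₂, hE₂, hmin₂, ha₁, ha₃, ha₂, h2c₄, h2c₆, h2Δ, -⟩ :=
    TwistAmplificationLemma.exists_reduced_model W₀ hE₀ hmin₀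
  -- the covariants of `W₀` in terms of `u = C.u`
  set u : ℚ := (C.u : ℚ) with hu
  have hu0 : u ≠ 0 := C.u.ne_zero
  have h4Q : u ^ 4 * (W₀.c₄ : ℚ) = 1296 * a := by
    have h := congrArg WeierstrassCurve.c₄ hCW
    rw [baseChange_int_c₄] at h
    rw [← h, variableChange_c₄, baseChange_int_c₄, hc₄, Units.val_inv_eq_inv_val, ← hu]
    push_cast
    field_simp
  have h6Q : u ^ 6 * (W₀.c₆ : ℚ) = 46656 * b := by
    have h := congrArg WeierstrassCurve.c₆ hCW
    rw [baseChange_int_c₆] at h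
    rw [← h, variableChange_c₆, baseChange_int_c₆, hc₆, Units.val_inv_eq_inv_val, ← hu]
    push_cast
    field_simp
  -- `u = m / n` in lowest terms; integer equations
  set m : ℤ := u.num with hm
  set n : ℕ := u.den with hn
  have hn0 : n ≠ 0 := u.den_nz
  have hun : u = m / n := (Rat.num_div_den u).symm
  have hnQ : (n : ℚ) ≠ 0 := by exact_mod_cast hn0
  have h4Z : m ^ 4 * W₀.c₄ = 1296 * a * (n : ℤ) ^ 4 := by
    have h : (m : ℚ) ^ 4 * (W₀.c₄ : ℚ) = 1296 * a * (n : ℚ) ^ 4 := by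
      rw [hun] at h4Q
      field_simp at h4Q
      linear_combination h4Q
    exact_mod_cast h
  have h6Z : m ^ 6 * W₀.c₆ = 46656 * b * (n : ℤ) ^ 6 := by
    have h : (m : ℚ) ^ 6 * (W₀.c₆ : ℚ) = 46656 * b * (n : ℚ) ^ 6 := by
      rw [hun] at h6Q
      field_simp at h6Q
      linear_combination h6Q
    exact_mod_cast h
  -- tower-freeness on both sides pins the unit
  have hTF₀ : TF (W₀.c₄, W₀.c₆) := by
    have h := tf_of_isMinimalAt (Δ_ne_zero_of_isElliptic_baseChange_int W₂) hmin₂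
    rwa [h2c₄, h2c₆] at h
  obtain ⟨hn1, hm0, hm36⟩ := twistUnit_of_tf h1 hTF hTF₀ hn0 u.reduced h4Z h6Z
  rw [hn1] at h4Z h6Z
  simp only [Nat.cast_one, one_pow, mul_one] at h4Z h6Z
  refine ⟨W₂, hE₂, hmin₂, ha₁, ha₃, ha₂, m, hm0, hm36, ?_, ?_⟩
  · rw [h2c₄]; exact h4Z
  · rw [h2c₆]; exact h6Z

end Summit.ABC.ABC.Theorems.SharpModerateLaw

end
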